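import Summits.QuantumFields.YangMills.Theorems.LuscherReductionRunningReductionTreeGauge
import HarnessLib

/-!
# The comb gauge has unit Jacobian: Haar push-forward under `treeFix` (sub-stub C4a′ of the fixed-lattice programme COARSE(L₀) — route
# `LuscherReduction`, crux RED stmt-QuantumFields-19978 KT-door 3b′ / crux `TwistedTraceScaling` stmt-QuantumFields-20203 S-BASE; design note
# `pub/ym-fleet/ym-luscher-20007-p1/COARSE-DESIGN.md` §4 brick (ii))

Companion of `…TreeGauge`.  The comb-gauge map `U ↦ treeFix U = (treeGauge U)·U` pushes the a-priori measure (product Haar) forward to the law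
of `killTree U` ("tree links frozen at `1`, the remaining `2L³ + 1` links independent Haar"):
* `killTree U e = 1` on tree edges, `U e` otherwise; `combMix U` = tree links of `U` kept, other links put in comb gauge; `killTree ∘ combMix = treeFix`;
* `measurePreserving_combMix` — `combMix` preserves product Haar: after splitting the links into tree / non-tree coordinates
  (`MeasurableEquiv.piEquivPiSubtypeProd`) it is a skew product over the tree coordinates whose fibre maps are two-sided translations of the
  non-tree links by transporters that READ ONLY TREE LINKS (`treeGauge_congr`) — Haar measure is bi-invariant (`WilsonGauge.measurePreserving_mul_mul`);
* ★ `map_treeFix_eq_map_killTree`, ★ `integral_comp_treeFix_eq`, ★ `integral_eq_integral_killTree_of_gaugeInvariant` — for a gauge-invariant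
  measurable `F`: `∫ F dμ = ∫ F(killTree U) dμ(U)` (no Faddeev–Popov determinant for axial gauges on the lattice).
HONEST FRAMING: lattice bookkeeping on a fixed lattice; femto rung R2b1; not a gap, not infinite volume, not Clay.
-/

set_option autoImplicit false

noncomputable section

open MeasureTheory Filter Topology Real
open scoped Matrix ComplexConjugate BigOperators
open Literature.MathematicalPhysics.QuantumFieldTheory
open Literature.MathematicalPhysics.QuantumLattice

namespace Summit.QuantumFields.YangMills.Theorems.FemtoTransferGap

variable {L : ℕ} [NeZero L]

/-! ## §1 Frozen tree links; the mixed configuration -/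

/-- **Tree links frozen at `1`**: `killTree U e = 1` on the comb tree, `U e` otherwise. [cite: SeilerLNP1982, §2] -/
def killTree (U : GaugeConfig 3 L SU2) : GaugeConfig 3 L SU2 := fun e => bif treeEdge e then 1 else U e

/-- **Mixed configuration**: the tree links of `U` unchanged, the other links in comb gauge. [folklore] -/
def combMix (U : GaugeConfig 3 L SU2) : GaugeConfig 3 L SU2 := fun e => bif treeEdge e then U e else treeFix U e

/-- `killTree ∘ combMix = treeFix`. [folklore] -/
theorem killTree_combMix (U : GaugeConfig 3 L SU2) : killTree (combMix U) = treeFix U := by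
  funext e
  unfold killTree combMix
  cases h : treeEdge e
  · rfl
  · exact (treeFix_eq_one_of_treeEdge U h).symm

omit [NeZero L] in
/-- `killTree` is measurable. [folklore] -/
theorem measurable_killTree : Measurable (killTree (L := L)) := by
  refine measurable_pi_iff.mpr fun e => ?_
  unfold killTree
  cases treeEdge e
  · exact measurable_pi_apply e
  · exact measurable_const

/-! ## §2 Tree / non-tree coordinates -/

variable (L) in
/-- Tree edges as an index type. [folklore] -/
abbrev TreeIdx : Type := {e : Edge 3 L // treeEdge e = true}

variable (L) in
/-- Non-tree edges as an index type. [folklore] -/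
abbrev OffIdx : Type := {e : Edge 3 L // ¬ treeEdge e = true}

/-- The measurable splitting of a configuration into its tree links and its non-tree links. [folklore] -/
def splitEquiv : GaugeConfig 3 L SU2 ≃ᵐ (TreeIdx L → SU2) × (OffIdx L → SU2) :=
  MeasurableEquiv.piEquivPiSubtypeProd (fun _ : Edge 3 L => SU2) (fun e : Edge 3 L => treeEdge e = true)

omit [NeZero L] in
/-- The splitting, first component. [folklore] -/
theorem splitEquiv_fst (U : GaugeConfig 3 L SU2) (i : TreeIdx L) : (splitEquiv U).1 i = U i.1 := rfl

omit [NeZero L] in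
/-- The splitting, second component. [folklore] -/
theorem splitEquiv_snd (U : GaugeConfig 3 L SU2) (i : OffIdx L) : (splitEquiv U).2 i = U i.1 := rfl

omit [NeZero L] in
/-- Recombination. [folklore] -/
theorem splitEquiv_symm_apply (q : (TreeIdx L → SU2) × (OffIdx L → SU2)) (e : Edge 3 L) :
    splitEquiv.symm q e = if h : treeEdge e = true then q.1 ⟨e, h⟩ else q.2 ⟨e, h⟩ := rfl

/-- Extension of tree data by `1` off the tree. [folklore] -/
def extOne (uT : TreeIdx L → SU2) : GaugeConfig 3 L SU2 := splitEquiv.symm (uT, fun _ => 1)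

omit [NeZero L] in
/-- On tree edges the extension returns the tree datum. [folklore] -/
theorem extOne_apply_of_tree (uT : TreeIdx L → SU2) {e : Edge 3 L} (h : treeEdge e = true) : extOne uT e = uT ⟨e, h⟩ := by
  unfold extOne
  rw [splitEquiv_symm_apply, dif_pos h]

omit [NeZero L] in
/-- The extension is measurable. [folklore] -/
theorem measurable_extOne : Measurable (extOne (L := L)) :=
  splitEquiv.symm.measurable.comp (measurable_id.prodMk measurable_const)

/-- **Fibre map**: two-sided translation of the non-tree links by the comb transporters of the tree data. [folklore] -/
def offMap (uT : TreeIdx L → SU2) (uN : OffIdx L → SU2) : OffIdx L → SU2 :=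
  fun i => treeGauge (extOne uT) i.1.1 * uN i * (treeGauge (extOne uT) (i.1.1.shift i.1.2))⁻¹

/-- **Skew product** `(u_T, u_N) ↦ (u_T, offMap u_T u_N)`. [folklore] -/
def skew (q : (TreeIdx L → SU2) × (OffIdx L → SU2)) : (TreeIdx L → SU2) × (OffIdx L → SU2) := (q.1, offMap q.1 q.2)

/-- ★ In tree / non-tree coordinates `combMix` is the skew product. [folklore] -/
theorem combMix_eq (U : GaugeConfig 3 L SU2) : combMix U = splitEquiv.symm (skew (splitEquiv U)) := by
  have hT : treeGauge (extOne (splitEquiv U).1) = treeGauge U :=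
    funext fun x => treeGauge_congr (fun e he => by rw [extOne_apply_of_tree _ he, splitEquiv_fst]) x
  funext e
  rw [splitEquiv_symm_apply]
  unfold combMix skew
  by_cases h : treeEdge e = true
  · rw [dif_pos h]
    simp only [h, cond_true]
    rfl
  · rw [dif_neg h]
    simp only [h]
    unfold offMap
    rw [hT, splitEquiv_snd]
    rfl

/-! ## §3 Measure preservation -/

/-- The fibre maps are jointly measurable. [folklore] -/
theorem measurable_offMap_uncurry : Measurable (Function.uncurry (offMap (L := L))) := by
  haveI : SecondCountableTopology SU2 := secondCountableTopology_su2
  have hA : ∀ x : Site 3 L, Measurable fun q : (TreeIdx L → SU2) × (OffIdx L → SU2) => treeGauge (extOne q.1) x := fun x =>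
    (continuous_treeGauge x).measurable.comp (measurable_extOne.comp measurable_fst)
  refine measurable_pi_iff.mpr fun i => ?_
  simp only [Function.uncurry, offMap]
  exact ((hA _).mul ((measurable_pi_apply i).comp measurable_snd)).mul (hA _).inv

/-- Each fibre map preserves product Haar on the non-tree links (Haar measure is bi-invariant). [cite: SeilerLNP1982, §2] -/
theorem map_offMap_eq (uT : TreeIdx L → SU2) :
    Measure.map (offMap uT) (Measure.pi fun _ : OffIdx L => haarProbability SU2) = Measure.pi fun _ : OffIdx L => haarProbability SU2 :=
  (measurePreserving_pi (fun _ : OffIdx L => haarProbability SU2) (fun _ : OffIdx L => haarProbability SU2)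
    (f := fun (i : OffIdx L) (w : SU2) => treeGauge (extOne uT) i.1.1 * w * (treeGauge (extOne uT) (i.1.1.shift i.1.2))⁻¹)
    fun _ => WilsonGauge.measurePreserving_mul_mul _ _).map_eq

/-- The skew product preserves the product of the two product Haar measures. [folklore] -/
theorem measurePreserving_skew : MeasurePreserving (skew (L := L))
    ((Measure.pi fun _ : TreeIdx L => haarProbability SU2).prod (Measure.pi fun _ : OffIdx L => haarProbability SU2))
    ((Measure.pi fun _ : TreeIdx L => haarProbability SU2).prod (Measure.pi fun _ : OffIdx L => haarProbability SU2)) :=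
  (MeasurePreserving.id _).skew_product measurable_offMap_uncurry (ae_of_all _ fun uT => map_offMap_eq uT)

/-- ★ **`combMix` preserves the a-priori measure.** [cite: SeilerLNP1982, §2] -/
theorem measurePreserving_combMix : MeasurePreserving (combMix (L := L)) (configMeasure SU2 L) (configMeasure SU2 L) := by
  have hΦ : MeasurePreserving (splitEquiv (L := L)) (configMeasure SU2 L)
      ((Measure.pi fun _ : TreeIdx L => haarProbability SU2).prod (Measure.pi fun _ : OffIdx L => haarProbability SU2)) :=
    measurePreserving_piEquivPiSubtypeProd (fun _ : Edge 3 L => haarProbability SU2) (fun e : Edge 3 L => treeEdge e = true)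
  have h := (hΦ.symm _).comp (measurePreserving_skew.comp hΦ)
  have hfun : (combMix (L := L)) = fun U => splitEquiv.symm (skew (splitEquiv U)) := funext combMix_eq
  rw [hfun]
  exact h

/-- `combMix` is measurable. [folklore] -/
theorem measurable_combMix : Measurable (combMix (L := L)) := measurePreserving_combMix.measurable

/-! ## §4 The push-forward and the integration formula -/

/-- ★★ **Unit Jacobian of the comb gauge**: the law of `treeFix U` under product Haar is the law of `killTree U` (tree links frozen at `1`,
the other links Haar). [cite: SeilerLNP1982, §2] -/
theorem map_treeFix_eq_map_killTree :
    (configMeasure SU2 L).map treeFix = (configMeasure SU2 L).map killTree := by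
  have h1 : (treeFix (L := L)) = killTree ∘ combMix := funext fun U => (killTree_combMix U).symm
  rw [h1, ← Measure.map_map measurable_killTree measurable_combMix, measurePreserving_combMix.map_eq]

/-- ★★ **Integration in the comb gauge**: `∫ F(treeFix U) dμ(U) = ∫ F(killTree U) dμ(U)` for measurable real `F`. [cite: SeilerLNP1982, §2] -/
theorem integral_comp_treeFix_eq {F : GaugeConfig 3 L SU2 → ℝ} (hF : Measurable F) :
    ∫ U, F (treeFix U) ∂configMeasure SU2 L = ∫ U, F (killTree U) ∂configMeasure SU2 L := by
  rw [← integral_map measurable_treeFix.aemeasurable hF.aestronglyMeasurable,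
    ← integral_map measurable_killTree.aemeasurable hF.aestronglyMeasurable, map_treeFix_eq_map_killTree]

/-- ★★ **Gauge-invariant integrands may be computed with the tree links frozen**: `∫ F dμ = ∫ F(killTree U) dμ(U)` for every measurable
gauge-invariant real `F`. [cite: SeilerLNP1982, §2] -/
theorem integral_eq_integral_killTree_of_gaugeInvariant {F : GaugeConfig 3 L SU2 → ℝ} (hF : Measurable F)
    (hg : ∀ (g : Site 3 L → SU2) (U : GaugeConfig 3 L SU2), F (gaugeTransform g U) = F U) :
    ∫ U, F U ∂configMeasure SU2 L = ∫ U, F (killTree U) ∂configMeasure SU2 L := by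
  rw [← integral_comp_treeFix_eq hF]
  exact integral_congr_ae (ae_of_all _ fun U => (eq_treeFix_of_gaugeInvariant hg U).symm)

/-- In particular for physical zero-flux test functions (and products with measurable gauge-invariant weights). [folklore] -/
theorem integral_eq_integral_killTree_of_isPhys {ψ : GaugeConfig 3 L SU2 → ℝ} (hψ : IsPhys ψ) :
    ∫ U, ψ U ∂configMeasure SU2 L = ∫ U, ψ (killTree U) ∂configMeasure SU2 L :=
  integral_eq_integral_killTree_of_gaugeInvariant hψ.measurable hψ.gaugeInv

end Summit.QuantumFields.YangMills.Theorems.FemtoTransferGap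

end
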